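import Mathlib.Topology.Algebra.OpenSubgroup
import Mathlib.GroupTheory.Coset.Basic
import Literature.NumberTheory.Automorphic.QuaternionicForms
import Literature.NumberTheory.Automorphic.HeckeAlgebraFixedPointsProofs
import HarnessLib

/-!
# Finiteness of `Dˣ \ D_fˣ / U`: reduction to one compact open level (Borel 1963, Thm. 5.1)

Sibling proof file of `Literature.NumberTheory.Automorphic.QuaternionicForms` (namespace
`Literature.Automorphic`), first step of the discharge of the named fact
`QuaternionicForm.finite_doubleQuotient` (`Dˣ \ D_fˣ / U` is finite for every *open* subgroup
`U ≤ D_fˣ = (D ⊗_K 𝔸_K^∞)ˣ`, `D` a quaternion algebra over a number field `K`).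

Borel (*Some finiteness properties of adele groups over number fields*, Publ. IHÉS 16 (1963))
proves, for any linear algebraic group `G` over a number field `k`:

* §1.2: `G_{𝔬_𝔭}` is a compact open subgroup of `G_𝔭`, `G_A^∞ := G_{A(∞)} = G_∞ × ∏_𝔭 G_{𝔬_𝔭}`,
  and `c(G)` is the number of double cosets `G_A^∞ x G_k`, `x ∈ G_A`;
* Thm. 5.1: "The number `c(G)` of distinct double cosets `G_A^∞ · x · G_k` (`x ∈ G_A`) is
  finite";
* Prop. 1.7 / proof of 5.1: for `x ∈ G_A`, `x G_A^∞ x⁻¹` is commensurable with `G_A^∞`, so the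
  count stays finite for every subgroup commensurable with `∏_𝔭 G_{𝔬_𝔭}`.

For `G = Dˣ` (`GL₁(D) ⊂ GL₄` by the regular representation) the archimedean factor `G_∞ = D_∞ˣ`
is all of the archimedean part of `G_A = D_∞ˣ × D_fˣ`, so `c(G) = #(Dˣ \ D_fˣ / U₀)` with
`U₀ = ∏_𝔭 G_{𝔬_𝔭}` a compact open subgroup of `D_fˣ`.  This file

1. proves the abstract **change-of-level lemma** for double quotients `Γ \ G / U`
   (`orbitRel.Quotient Γ (G ⧸ U)`, the formulation of `finite_doubleQuotient`):
   `finite_doubleQuotient_mono` (a smaller level has more double cosets),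
   `finite_doubleQuotient_of_le` (passing to a subgroup of finite index multiplies the count by
   at most the index) and the topological corollary
   `finite_doubleQuotient_of_isCompact_of_isOpen`: if `Γ \ G / U₀` is finite for one *compact*
   subgroup `U₀`, it is finite for every *open* subgroup `U` (`U ∩ U₀` is open of finite index in
   the compact group `U₀`, Mathlib `Subgroup.quotient_finite_of_isOpen`) — this is exactly the
   commensurability step of Borel's proof of Thm. 5.1;
2. vendors Borel's Thm. 5.1 for `G = Dˣ` as the named fact
   `QuaternionicForm.exists_isCompact_isOpen_finite_doubleQuotient` (there is a compact open
   `U₀ ≤ D_fˣ` with `Dˣ \ D_fˣ / U₀` finite);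
3. proves `QuaternionicForm.finite_doubleQuotient_of_exists`: that fact implies
   `finite_doubleQuotient U` for every `U`.

The discharge of `exists_isCompact_isOpen_finite_doubleQuotient` itself (compactness of
`𝒪̂_K`, the adelic lattice dictionary of Weil, *Basic Number Theory*, Ch. V §2 Thm. 2, and the
finiteness of the class set of an order, Jordan–Zassenhaus) is left to sibling files.

A second, independent section discharges the named fact `QuaternionicForm.heckeOperator_comm`
(commutativity of the Hecke operators `T_g = [UgU]` on `M(U, R)` under the Gelfand-pair
hypothesis `IsGelfandPair ℤ D_fˣ U`): for a Hecke pair `(G, K)` with commutative Hecke algebra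
`ℋ(G, K) = End_G(k[G ⧸ K])`, the operators `[KgK]`, `[Kg'K]` commute on the `K`-fixed vectors of
every representation of `G` over `k` (`heckeOperator_heckeOperator_comm_of_isGelfandPair`, from the
discharged facts `exists_algHom_moduleEnd_fixedPoints_holds` — `V^K` is an `ℋ(G, K)ᵐᵒᵖ`-module —
and `exists_basis_heckeAlgebra_holds` — the basis element of `KgK` acts by `[KgK]`); this is applied
to the right translation representation of `D_fˣ` on all functions `D_fˣ → R`
(`QuaternionicForm.rightRegularFun`), on whose `U`-fixed vectors `[UgU]` restricts to `T_g`
(`QuaternionicForm.coe_heckeOperator`; Gross 1999, §4, eq. (4.4) and Prop. 4.3 — the locators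
carried by the fact; Shimura 1971, Prop. 3.38 and Thm. 3.41 for the mechanism "a commutative Hecke
ring acts on invariants by mutually commutative operators"; Cartier 1979, §IV.1).

## References

* A. Borel, *Some finiteness properties of adele groups over number fields*, Publ. Math. IHÉS 16
  (1963), 5–30: §1.2, Prop. 1.7, Thm. 5.1.
* A. Weil, *Basic Number Theory* (1967), Ch. V §2 (lattices over number fields).
* B. H. Gross, *Algebraic modular forms*, Israel J. Math. 113 (1999), 61–93, §4.
* G. Shimura, *Introduction to the arithmetic theory of automorphic functions* (1971), §3.1
  (Prop. 3.8), §3.4 (Prop. 3.38), §3.5 (Thm. 3.41).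
* P. Cartier, *Representations of p-adic groups: a survey*, Proc. Sympos. Pure Math. 33 (1979),
  part 1, §IV.1.
-/

noncomputable section

open MulAction

universe u

namespace Literature.NumberTheory.Automorphic

/-! ### Double quotients `Γ \ G / U` and change of level -/

section DoubleQuotient

variable {G : Type*} [Group G] (Γ : Subgroup G)

/-- The natural map `Γ \ G / U → Γ \ G / U'` for `U ≤ U'`, induced by `G ⧸ U → G ⧸ U'`
(Mathlib `Subgroup.quotientMapOfLE`, which is `Γ`-equivariant). [folklore] -/
def doubleQuotientMapOfLE {U U' : Subgroup G} (h : U ≤ U') :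
    orbitRel.Quotient Γ (G ⧸ U) → orbitRel.Quotient Γ (G ⧸ U') :=
  Quotient.map' (Subgroup.quotientMapOfLE h) fun a b hab => by
    obtain ⟨γ, rfl⟩ := hab
    refine ⟨γ, ?_⟩
    induction b using QuotientGroup.induction_on
    rfl

/-- `doubleQuotientMapOfLE` on representatives. [folklore] -/
@[simp]
theorem doubleQuotientMapOfLE_mk {U U' : Subgroup G} (h : U ≤ U') (g : G) :
    doubleQuotientMapOfLE Γ h (Quotient.mk'' (g : G ⧸ U)) = Quotient.mk'' (g : G ⧸ U') :=
  rfl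

/-- `Γ \ G / U → Γ \ G / U'` is surjective for `U ≤ U'`. [folklore] -/
theorem doubleQuotientMapOfLE_surjective {U U' : Subgroup G} (h : U ≤ U') :
    Function.Surjective (doubleQuotientMapOfLE Γ h) := by
  intro q
  induction q using Quotient.inductionOn' with
  | h x =>
    induction x using QuotientGroup.induction_on with
    | H g => exact ⟨Quotient.mk'' (g : G ⧸ U), rfl⟩

/-- **Change of level, monotonicity**: if `Γ \ G / U` is finite and `U ≤ U'` then `Γ \ G / U'` is
finite. [folklore] -/
theorem finite_doubleQuotient_mono {U U' : Subgroup G} (h : U ≤ U')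
    (hU : Finite (orbitRel.Quotient Γ (G ⧸ U))) : Finite (orbitRel.Quotient Γ (G ⧸ U')) :=
  Finite.of_surjective _ (doubleQuotientMapOfLE_surjective Γ h)

/-- The quotient map `G ⧸ W → G ⧸ V` (`W ≤ V`) is `Γ`-equivariant. [folklore] -/
theorem quotientMapOfLE_smul {W V : Subgroup G} (h : W ≤ V) (γ : Γ) (x : G ⧸ W) :
    Subgroup.quotientMapOfLE h (γ • x) = γ • Subgroup.quotientMapOfLE h x := by
  induction x using QuotientGroup.induction_on
  rfl

/-- The first component of Mathlib's `G ⧸ W ≃ (G ⧸ V) × V ⧸ W` is the quotient map. [folklore] -/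
theorem quotientEquivProdOfLE_fst {W V : Subgroup G} (h : W ≤ V) (x : G ⧸ W) :
    (Subgroup.quotientEquivProdOfLE h x).1 = Subgroup.quotientMapOfLE h x := by
  induction x using QuotientGroup.induction_on
  rfl

/-- **Change of level, finite index**: if `W ≤ V` has finite index and `Γ \ G / V` is finite then
`Γ \ G / W` is finite; indeed every double coset `Γ x W` meets the finite fibre of `G ⧸ W → G ⧸ V`
over a fixed representative of `Γ x V`, so `#(Γ \ G / W) ≤ #(Γ \ G / V) · [V : W]`
(the counting step in Borel 1963, proof of Thm. 5.1). [folklore] -/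
theorem finite_doubleQuotient_of_le {W V : Subgroup G} (h : W ≤ V)
    [Finite (V ⧸ W.subgroupOf V)] (hV : Finite (orbitRel.Quotient Γ (G ⧸ V))) :
    Finite (orbitRel.Quotient Γ (G ⧸ W)) := by
  classical
  let e := Subgroup.quotientEquivProdOfLE h
  let ψ : orbitRel.Quotient Γ (G ⧸ V) × V ⧸ W.subgroupOf V → orbitRel.Quotient Γ (G ⧸ W) :=
    fun p => Quotient.mk'' (e.symm (p.1.out, p.2))
  refine Finite.of_surjective ψ fun z => ?_
  induction z using Quotient.inductionOn' with
  | h x =>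
    -- `x : G ⧸ W`; its image `y` in `G ⧸ V`, and the chosen representative of `Γ y`
    set y : G ⧸ V := Subgroup.quotientMapOfLE h x with hy
    obtain ⟨γ, hγ⟩ : (Quotient.mk'' y : orbitRel.Quotient Γ (G ⧸ V)).out ∈ orbit Γ y :=
      @Quotient.mk_out' _ (orbitRel Γ (G ⧸ V)) y
    -- `γ • x` lies over the representative, and in the same double coset as `x`
    refine ⟨(Quotient.mk'' y, (e (γ • x)).2), ?_⟩
    have h1 : (e (γ • x)).1 = (Quotient.mk'' y : orbitRel.Quotient Γ (G ⧸ V)).out := by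
      rw [quotientEquivProdOfLE_fst, quotientMapOfLE_smul, ← hy]
      exact hγ
    have h2 : e.symm ((Quotient.mk'' y : orbitRel.Quotient Γ (G ⧸ V)).out, (e (γ • x)).2) =
        γ • x := by
      rw [← h1, Prod.mk.eta, Equiv.symm_apply_apply]
    change Quotient.mk'' (e.symm (_, _)) = _
    rw [h2]
    exact Quotient.sound' ⟨γ, rfl⟩

/-- **Change of level, topological form** (the commensurability step of Borel 1963, Prop. 1.7 and
proof of Thm. 5.1): in a topological group, if `Γ \ G / U₀` is finite for a *compact* subgroup
`U₀`, then `Γ \ G / U` is finite for every *open* subgroup `U`, because `U ∩ U₀` is an open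
subgroup of the compact group `U₀`, hence of finite index
(Mathlib `Subgroup.quotient_finite_of_isOpen`). [cite: BorelIHES1963, Prop. 1.7 and Thm. 5.1 (proof)] -/
theorem finite_doubleQuotient_of_isCompact_of_isOpen [TopologicalSpace G] [IsTopologicalGroup G]
    (U₀ U : Subgroup G) (hU₀ : IsCompact (U₀ : Set G)) (hU : IsOpen (U : Set G))
    (hfin : Finite (orbitRel.Quotient Γ (G ⧸ U₀))) : Finite (orbitRel.Quotient Γ (G ⧸ U)) := by
  haveI : CompactSpace U₀ := isCompact_iff_compactSpace.mp hU₀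
  haveI : Finite (U₀ ⧸ (U ⊓ U₀).subgroupOf U₀) := by
    rw [Subgroup.inf_subgroupOf_right]
    exact Subgroup.quotient_finite_of_isOpen _ (Subgroup.subgroupOf_isOpen U₀ U hU)
  exact finite_doubleQuotient_mono Γ (inf_le_left : U ⊓ U₀ ≤ U)
    (finite_doubleQuotient_of_le Γ (inf_le_right : U ⊓ U₀ ≤ U₀) hfin)

end DoubleQuotient

/-! ### The quaternionic double quotient -/

namespace QuaternionicForm

variable {K : Type} [Field K] [NumberField K] {D : Type u} [Ring D] [Algebra K D]

/-- **Finiteness of the class number of `Dˣ`** (Borel 1963, Thm. 5.1, for the algebraic group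
`G = Dˣ = GL₁(D)` over `K`, `D` a quaternion algebra): there is a compact open subgroup
`U₀ ≤ D_fˣ = (D ⊗_K 𝔸_K^∞)ˣ` such that the double quotient `Dˣ \ D_fˣ / U₀` is finite.
In Borel's notation `U₀ = ∏_𝔭 G_{𝔬_𝔭}`, which is compact open (§1.2), `G_A^∞ = G_∞ × U₀`, and
since `G_∞ = D_∞ˣ` exhausts the archimedean component of `G_A = D_∞ˣ × D_fˣ`, Borel's class
number `c(G) = #(G_A^∞ \ G_A / G_k)` equals `#(Dˣ \ D_fˣ / U₀)` (inverting `x ↦ x⁻¹` to pass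
from `U₀ x Dˣ` to `Dˣ x⁻¹ U₀`); Thm. 5.1 says `c(G) < ∞`. Classically (Vignéras III §5) this is
the finiteness of the number of classes of left ideals of an order of `D`. Stated, like
`finite_doubleQuotient`, with `Dˣ` acting through `inclFinite` on `D_fˣ ⧸ U₀`. [cite: BorelIHES1963, §1.2 and Thm. 5.1] -/
def exists_isCompact_isOpen_finite_doubleQuotient : Prop :=
  ∀ [IsQuaternionAlgebra K D], ∃ U₀ : Subgroup (finiteAdelicUnits K D),
    IsCompact (U₀ : Set (finiteAdelicUnits K D)) ∧ IsOpen (U₀ : Set (finiteAdelicUnits K D)) ∧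
      Finite (MulAction.orbitRel.Quotient (inclFinite K D).range (finiteAdelicUnits K D ⧸ U₀))

variable (U : Subgroup (finiteAdelicUnits K D))

/-- **Reduction of `finite_doubleQuotient` to one compact open level**: if `Dˣ \ D_fˣ / U₀` is
finite for some compact open `U₀` (Borel 1963, Thm. 5.1: `exists_isCompact_isOpen_finite_doubleQuotient`),
then `Dˣ \ D_fˣ / U` is finite for every open subgroup `U ≤ D_fˣ` (`finite_doubleQuotient U`), by
the change-of-level lemma `finite_doubleQuotient_of_isCompact_of_isOpen`. [cite: BorelIHES1963, Thm. 5.1] -/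
theorem finite_doubleQuotient_of_exists
    (h : exists_isCompact_isOpen_finite_doubleQuotient (K := K) (D := D)) :
    finite_doubleQuotient U := by
  intro _ hU
  obtain ⟨U₀, hc, ho, hf⟩ := h
  exact finite_doubleQuotient_of_isCompact_of_isOpen _ U₀ U hc hU hf

end QuaternionicForm

end Literature.NumberTheory.Automorphic

/-! ### Commutativity of the Hecke operators on `M(U, R)` (discharge of `heckeOperator_comm`)

For a Hecke pair `(G, K)` whose Hecke algebra `ℋ(G, K) = End_G(k[G ⧸ K])` is commutative
(`IsGelfandPair k G K`), the concrete Hecke operators `[KgK]`, `[Kg'K]` of `HeckeAlgebra` commute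
on the `K`-fixed vectors `V^K` of every representation `ρ` of `G` over `k`: by
`exists_algHom_moduleEnd_fixedPoints_holds` there is a `k`-algebra map
`a : ℋ(G, K)ᵐᵒᵖ →ₐ[k] End_k(V^K)` under which an element `T` with `T [K] = 𝟙_{KgK}` acts by
`[KgK]`, and by `exists_basis_heckeAlgebra_holds` such a `T = T_g` exists for every `g`; hence
`[KgK] [Kg'K] = a(op T_g) a(op T_{g'}) = a(op (T_{g'} T_g)) = a(op (T_g T_{g'})) = [Kg'K] [KgK]`
on `V^K` (Cartier 1979, §IV.1; classically Shimura 1971, Prop. 3.38: the double-coset action on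
invariants is multiplicative, `[XY]_k = [X]_k [Y]_k`, whence Thm. 3.41: a commutative Hecke ring
acts by mutually commutative operators). The space `M(U, R)` of quaternionic forms of level `U`
sits inside the `U`-fixed vectors of the right translation representation of `D_fˣ` on all
functions `D_fˣ → R` (over `ℤ`), and there `[UgU]` restricts to `T_g`
(`QuaternionicForm.coe_heckeOperator`), both being the sum `∑_{yU ⊆ UgU} f(x y)` over the same
representatives (Gross 1999, §4, eq. (4.4)). -/

namespace Literature.NumberTheory.Automorphic

section GelfandPairCommute

variable {k G V : Type*} [CommRing k] [Group G] (K : Subgroup G)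
  [IsHeckeTriple (⊤ : Submonoid G) K K] [AddCommGroup V] [Module k V] (ρ : Representation k G V)

/-- **Hecke operators of a Gelfand pair commute on `K`-fixed vectors.** For a Hecke pair `(G, K)`
with commutative Hecke algebra `ℋ(G, K) = End_G(k[G ⧸ K])` (`IsGelfandPair k G K`) and any
representation `ρ` of `G` on a `k`-module `V`, the Hecke operators `[KgK]` and `[Kg'K]` commute
on `V^K`: `V^K` is a module over `ℋ(G, K)ᵐᵒᵖ` (`exists_algHom_moduleEnd_fixedPoints_holds`) on
which the basis element of `KgK` (`exists_basis_heckeAlgebra_holds`) acts by `[KgK]`, and the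
opposite of a commutative algebra is commutative (Shimura 1971, Prop. 3.38, p. 77: the action of
the Hecke ring on invariants is multiplicative, whence Thm. 3.41: the operators of a commutative
Hecke ring are mutually commutative; Cartier 1979, §IV.1 for `V^K` as an `ℋ(G, K)`-module).
[cite: Shimura1971, Prop. 3.38 and Thm. 3.41] -/
theorem heckeOperator_heckeOperator_comm_of_isGelfandPair (hG : IsGelfandPair k G K) (g g' : G)
    {v : V} (hv : v ∈ ρ.fixedPoints K) :
    heckeOperator ρ K g (heckeOperator ρ K g' v) =
      heckeOperator ρ K g' (heckeOperator ρ K g v) := by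
  obtain ⟨a, ha⟩ := exists_algHom_moduleEnd_fixedPoints_holds k G K (V := V) ρ
  obtain ⟨b, hb⟩ := exists_basis_heckeAlgebra_holds k G K
  -- the basis elements `T = T_g`, `T' = T_{g'}` of `ℋ(G, K)`: `T [K] = 𝟙_{KgK}`
  obtain ⟨T, hT⟩ : ∃ T : heckeAlgebra k G K, (T : Module.End k (MonoidAlgebra k (G ⧸ K)))
      (MonoidAlgebra.single ((1 : G) : G ⧸ K) 1) = doubleCosetIndicator k G K g := ⟨_, hb g⟩
  obtain ⟨T', hT'⟩ : ∃ T : heckeAlgebra k G K, (T : Module.End k (MonoidAlgebra k (G ⧸ K)))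
      (MonoidAlgebra.single ((1 : G) : G ⧸ K) 1) = doubleCosetIndicator k G K g' := ⟨_, hb g'⟩
  have h₁ : ∀ w : ρ.fixedPoints K, (a (MulOpposite.op T) w : V) = heckeOperator ρ K g w :=
    ha T g hT
  have h₂ : ∀ w : ρ.fixedPoints K, (a (MulOpposite.op T') w : V) = heckeOperator ρ K g' w :=
    ha T' g' hT'
  -- `ℋ(G, K)` is commutative, hence so is the image of `ℋ(G, K)ᵐᵒᵖ` in `End_k(V^K)`
  have hcomm : a (MulOpposite.op T) * a (MulOpposite.op T') =
      a (MulOpposite.op T') * a (MulOpposite.op T) := by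
    rw [← map_mul, ← map_mul, ← MulOpposite.op_mul, ← MulOpposite.op_mul, hG T T']
  have key := congrArg Subtype.val (LinearMap.congr_fun hcomm ⟨v, hv⟩)
  simp only [Module.End.mul_apply, h₁, h₂] at key
  exact key

end GelfandPairCommute

namespace QuaternionicForm

section HeckeComm

variable {K : Type} [Field K] [NumberField K] {D : Type u} [Ring D] [Algebra K D]
  {U : Subgroup (finiteAdelicUnits K D)} {R : Type*} [AddCommGroup R]

variable (R) in
/-- The **right translation representation** of `D_fˣ` on all functions `φ : D_fˣ → R`,
`(r(g) φ)(x) = φ (x g)`, over any commutative ring `k` acting on `R` (Gross 1999, §4: `M(U, R)`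
is the space of left-`Dˣ`-invariant, right-`U`-invariant functions, i.e. of `U`-fixed vectors
of right translation on `Dˣ`-invariant functions; Mathlib's `Representation.rightRegular`
(`RepresentationTheory/Tannaka`) is the case `R = k`). [folklore] -/
def rightRegularFun (k : Type*) [CommRing k] [Module k R] :
    Representation k (finiteAdelicUnits K D) (finiteAdelicUnits K D → R) where
  toFun g :=
    { toFun := fun φ x => φ (x * g)
      map_add' := fun _ _ => rfl
      map_smul' := fun _ _ => rfl }
  map_one' := by ext; simp
  map_mul' g g' := by ext; simp [mul_assoc]

/-- `rightRegularFun R k g φ x = φ (x * g)`. [folklore] -/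
@[simp] theorem rightRegularFun_apply (k : Type*) [CommRing k] [Module k R]
    (g : finiteAdelicUnits K D) (φ : finiteAdelicUnits K D → R) (x : finiteAdelicUnits K D) :
    rightRegularFun R k g φ x = φ (x * g) := rfl

/-- A quaternionic form of level `U`, as a function `D_fˣ → R`, is a `U`-fixed vector of the
right translation representation (the right `U`-invariance of Gross 1999, §4, eq. (4.1), as
vendored in `QuaternionicForm`). [folklore] -/
theorem coe_mem_fixedPoints_rightRegularFun (k : Type*) [CommRing k] [Module k R]
    (f : QuaternionicForm D U R) : ⇑f ∈ (rightRegularFun R k).fixedPoints U := by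
  rw [Representation.mem_fixedPoints]
  intro u hu
  funext x
  rw [rightRegularFun_apply]
  exact f.right_invt hu x

variable (S : Type*) [Semiring S] [Module S R]
  [IsHeckeTriple (⊤ : Submonoid (finiteAdelicUnits K D)) U U]

/-- **`T_g` is the double-coset operator `[UgU]` of `HeckeAlgebra`** on the function `⇑f`, for
the right translation representation over `ℤ`: both are `∑_{yU ⊆ UgU} f (x y)` over the
representatives `y = Quotient.out (yU)` (the sum (4.4) of Gross 1999, §4, as vendored in
`QuaternionicForm.heckeOperator` and in `Automorphic.heckeOperator`; definitional up to
exchanging a finite sum with evaluation). [folklore] -/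
theorem coe_heckeOperator (g : finiteAdelicUnits K D) (f : QuaternionicForm D U R) :
    ⇑(heckeOperator S g f) = Automorphic.heckeOperator (rightRegularFun R ℤ) U g ⇑f := by
  funext x
  rw [heckeOperator_apply, Automorphic.heckeOperator,
    finsum_mem_eq_finite_toFinset_sum _ (finite_orbit_quotient U g),
    finsum_mem_eq_finite_toFinset_sum _ (finite_orbit_quotient U g), LinearMap.sum_apply,
    Finset.sum_apply]
  rfl

/-- **Discharge of `heckeOperator_comm`** (Gross 1999, §4, Prop. 4.3, the locator carried by the
fact; mechanism of Shimura 1971, Prop. 3.38 and Thm. 3.41; Cartier 1979, §IV.1): if `(D_fˣ, U)`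
is a Gelfand pair over `ℤ`, i.e. the Hecke algebra
`ℋ(D_fˣ, U) = End_{D_fˣ}(ℤ[D_fˣ ⧸ U])` is commutative, then the Hecke operators `T_g`, `T_{g'}`
on `M(U, R)` commute, for every coefficient group `R` and scalar semiring `S`. Proof: `M(U, R)`
embeds (`f ↦ ⇑f`) into the `U`-fixed vectors of the right translation representation of `D_fˣ`
on `D_fˣ → R` (`coe_mem_fixedPoints_rightRegularFun`), where `T_g` is `[UgU]`
(`coe_heckeOperator`) and `[UgU]`, `[Ug'U]` commute by
`heckeOperator_heckeOperator_comm_of_isGelfandPair`. [cite: Gross1999, §4 Prop. 4.3] -/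
theorem heckeOperator_comm_holds : heckeOperator_comm (U := U) (R := R) S := by
  intro hG g g'
  refine LinearMap.ext fun f => ext fun x => ?_
  have h := heckeOperator_heckeOperator_comm_of_isGelfandPair U (rightRegularFun R ℤ) hG g g'
    (coe_mem_fixedPoints_rightRegularFun ℤ f)
  simp only [LinearMap.comp_apply, coe_heckeOperator S]
  exact congrFun h x

end HeckeComm

end QuaternionicForm

end Literature.NumberTheory.Automorphic
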